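import Literature.NumberTheory.ModularForms.EtaMultiplierRademacherPhi
import Mathlib.NumberTheory.DirichletCharacter.Basic
import HarnessLib
import HarnessLib.Audit.Tags

/-!
# Sketch-an-g34 — cell bsd-f2-manin, seat -an (analytic / period-lattice lens), generation 34.  NOTHING ASSERTED.


TYPER NOTE (typer g18, T-an-35).  SOURCE = HOME/an/g34/Sketch-an-g34.lean sha16 42de86c61644d9a2 (75 l.; an: farm rc 0) — §1 below, VERBATIM,
with `@[conjecture]` on E-an-154 `SigmaTwoIsEtaKummerAtFour` and E-an-155 `EtaSquareKummerIsSigmaAtFour` (obligation nodes; an §77.7: E-an-154 IS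
the generalized Ogg conjecture restricted to the Shimura 2-torsion at `4 ∣ N` — the part print excludes), and the sketch's closing sanity `example`
DROPPED (it restates the tree theorem `etaQuotient_logPeriod_mem_int` — gate `dedup.landed`; E-an-154/155 quantify over that integer's parity).  §2 = HOME/an/g34/
EtaSquareSigmaSkeleton-an-g34.lean sha16 bb9ba7db8d2011f0 (an's CHECKED SKELETON for E-an-155: everything but its one stub is proved), landed as:
the stub's statement as the node `@[conjecture] def ShimuraTwoCharOfJacobiProductAtFour` (S-an-g34-1: the Jacobi part of Newman's multiplier of
`G_r` on `Γ₀(N)` is an even quadratic Dirichlet character mod `N` unramified at the cusps), an's PROVED lemmas `mod24_of_hasEvenCuspOrders`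
(Ligozat at the cusps `∞`, `0` ⟹ Newman's two mod-24 congruences), `cexp_pi_I_mul_int_eq_one_iff'`, `dirichletChar_int_sq_eq_one` VERBATIM, and
an's composition VERBATIM with the stub threaded as a hypothesis: **`etaSquareKummerIsSigmaAtFour_of_jacobiProduct :
ShimuraTwoCharOfJacobiProductAtFour → EtaSquareKummerIsSigmaAtFour`** (E-an-155 ⟸ S-an-g34-1, over the tree theorem
`sum_rademacherPhi_conj_eq_of_odd`).  Imports = the sketch's (Literature `EtaMultiplierRademacherPhi` + Mathlib) — ROUTE-INDEPENDENT; no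
Literature fact created.

HONEST FRAMING.  LENS: an (analytic / period-lattice: `H¹(X₀(N), 𝔽₂)`, Kummer classes of η-quotients vs the Shimura subgroup `Σ(N)[2]` at
`4 ∣ N`).  STATUS: E-an-154/155 are level-only LAWS, decidable per `N`, CONJECTURAL (ENGINE 2 h1f2.py 60ce9f5b70927dfe, table
HOME/an/g34/H1F2-4N-v1.tsv sha16 02afa8ee56df14a3: 268/268 levels `4 ∣ N ≤ 932` + `1004…1140`; BC5 witness); E-an-155 is an's
«theorem-grade candidate», here PROVED modulo the single node S-an-g34-1.  REFUTER VERDICTS: R-an-63 (ref1: the dictionary lines §77.1 (iii)–(v)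
and this typing) PENDING at filing; ref2 placement (Mazur prime level; Ling 1997; Ohta 2014; Yoo 2023 away from 6N) per an §77.7.  WHY IT MATTERS:
the 10 blind `16 ∣ N` rows of C2's stub 6♭ have `ι(T) = σ_χ ∈ Σ(N)[2]` (an §77.4); E-an-154 names those classes as η-Kummer classes.  PARTITION
currency: 0; beyond-print theorem: NO; bears_on: stmt-BirchSwinnertonDyer-22967 (C2).  BSD is not proved by this; Manin's conjecture is not proved;
C2/C3 OPEN.
Typed candidates of MEMO-an §77 (the `Σ(N)[2] = η²`-law at `4 ∣ N`), stated over tree declarations only: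
`NewmanCond`, `cuspOrder24` (Literature/NumberTheory/EllipticCurves/ModularCurveEtaQuotientsProofs),
`rademacherPhi` (Literature/NumberTheory/ModularForms/DedekindSumRademacherPhi), Mathlib's `DirichletCharacter`.

Dictionary (MEMO-an §77.2).  For `γ = (a b; c d) ∈ Γ₀(N)`, `c > 0`, and an `η`-quotient `G_r = ∏_{δ∣N} η(δτ)^{r_δ}` with
`NewmanCond N r 0`, the LOG-PERIOD `P_r(γ) := (Σ_δ r_δ Φ(a, δb, c/δ, d))/24` is an integer (tree theorem
`etaQuotient_logPeriod_mem_int`) and `γ ↦ P_r(γ) mod 2` is the KUMMER CLASS `κ(G_r) ∈ H¹(X₀(N), 𝔽₂) = Hom(Γ₀(N), 𝔽₂)` of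
`√G_r` whenever every cusp order of `G_r` is even (`48·c·gcd(c,N/c) ∣ cuspOrder24 N r c` for all `c ∣ N`; Ligozat).  An even
quadratic Dirichlet character `χ mod N` killing every cusp stabiliser `d = 1 + a·c·(N/gcd(N,c²))` is a `2`-torsion SHIMURA
class `σ_χ(γ) = [χ(d) = −1]` (`Σ(N)[2] = ker(J₀(N) → J₁(N))[2]`, Ling–Oesterlé).

ENGINE 2 census (h1f2.py, exact; H1F2-4N-v1.tsv sha16 02afa8ee56df14a3): for all 268 levels `4 ∣ N` run
(`4 ∣ N ≤ 932` complete, `1004 ≤ N ≤ 1140`): `{κ(G_{2r'})} = Σ(N)[2]` (dimensions 0:38, 1:150, 2:75, 3:5) — both inclusions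
below hold 268/268; cheapest falsifier = one more level.
-/

namespace Summit.BirchSwinnertonDyer.Rank1Residual.ManinAdditive.SigmaEta

open Literature.NumberTheory.ModularForms
open Literature.NumberTheory.EllipticCurves.ModularForms
open Complex
open scoped Real NumberTheorySymbols

/-! ## §1 The objects and rows E-an-154 / E-an-155 (Sketch-an-g34 42de86c61644d9a2, verbatim; `@[conjecture]` added) -/

/-- `χ` (a `ℤ`-valued, hence quadratic, Dirichlet character mod `N`) is EVEN and kills every cusp stabiliser of `Γ₀(N)`:
`χ(−1) = 1` and `χ(1 + a·c·w_c) = 1` for `c ∣ N`, `gcd(a,c) = 1`, `w_c = N/gcd(N,c²)` the width of the cusp `a/c`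
(so `γ ↦ [χ(d_γ) = −1]` factors through `π₁(X₀(N))`: a class of `Σ(N)[2]`). -/
def IsShimuraTwoChar (N : ℕ) (χ : DirichletCharacter ℤ N) : Prop :=
  χ (-1) = 1 ∧ ∀ a c : ℕ, c ∣ N → Nat.Coprime a c → χ ((1 + a * c * (N / Nat.gcd N (c * c)) : ℕ) : ZMod N) = 1

/-- The `η`-quotient with exponents `r` has EVEN order at every cusp of `X₀(N)` (Ligozat: the order at a cusp of
denominator `c ∣ N` is `cuspOrder24 N r c / (24·c·gcd(c,N/c))`). -/
def HasEvenCuspOrders (N : ℕ) (r : ℕ → ℤ) : Prop :=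
  ∀ c ∈ N.divisors, (48 * (c : ℤ) * (Nat.gcd c (N / c) : ℤ)) ∣ cuspOrder24 N r c

/-- The Kummer class of `√G_r` equals the Shimura class of `χ`: for every `γ = (a b; c d) ∈ Γ₀(N)` with `c > 0` the
log-period `P_r(γ)` is an integer whose parity is `[χ(d) = −1]`. -/
def KummerClassEqShimura (N : ℕ) (r : ℕ → ℤ) (χ : DirichletCharacter ℤ N) : Prop :=
  ∀ a b c d : ℤ, a * d - b * c = 1 → 0 < c → (N : ℤ) ∣ c →
    ∃ n : ℤ, (∑ t ∈ N.divisors, (r t : ℚ) * rademacherPhi a (t * b) (c / t) d) / 24 = n ∧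
      (Even n ↔ χ (d : ZMod N) = 1)

/-- **Candidate E-an-154 `SigmaTwoIsEtaKummerAtFour` (level-only LAW, decidable per `N`; cell bsd-f2-manin, an g34;
nothing asserted): at `4 ∣ N` every `2`-torsion Shimura class is the Kummer class of a plain `η`-quotient with even cusp
orders** — equivalently `Σ(N)[2] ⊆ C_η(N)`: the class `σ_χ ∈ J₀(N)[2]` is the class of the rational cuspidal divisor
`½·div G_r`.  (Prime level: Mazur's `C ∩ Σ = C[2] = Σ[2]`, Prop. II.11.11; here `N` is NOT square-free and `dim Σ(N)[2] ≤ 3`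
in range.)  ENGINE 2: 268/268 levels.  Why it might fail: a level `4 ∣ N` whose unit group needs generalized Dedekind
`η`-functions (Wang–Yang levels `n²M`, `n ∣ 24`) to realise some `σ_χ`; none `≤ 1140` in range.
[cite: LingOesterle1991, Thm. 6 (shape only: the structure of Σ(N); this η-realisation law is NOT in print — cell memo MEMO-an §77)] -/
@[conjecture]
def SigmaTwoIsEtaKummerAtFour : Prop :=
  ∀ (N : ℕ), 4 ∣ N → ∀ χ : DirichletCharacter ℤ N, IsShimuraTwoChar N χ →
    ∃ r : ℕ → ℤ, NewmanCond N r 0 ∧ HasEvenCuspOrders N r ∧ KummerClassEqShimura N r χ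

/-- **Candidate E-an-155 `EtaSquareKummerIsSigmaAtFour` (level-only LAW, theorem-grade candidate; cell bsd-f2-manin, an g34;
nothing asserted): at `4 ∣ N` the Kummer class of the square `G_{2r}` of an `η`-quotient `G_r` (weight `0`, the mod-`12`
Newman congruences, INTEGRAL cusp orders) is a `2`-torsion Shimura class** — i.e. `G_r` transforms under `Γ₀(N)` by an even
quadratic Dirichlet character `mod N` unramified at the cusps (`V_sq(N) ⊆ Σ(N)[2]`; with E-an-154: `V_sq(N) = Σ(N)[2]`).
ENGINE 2: 268/268 levels.  Why it might fail: an `η`-quotient with mod-`12` (not mod-`24`) congruences whose multiplier on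
`Γ₀(N)` involves the `η`-multiplier beyond `(ℤ/N)ˣ` (excluded in range).
[cite: Newman1959, Thm. 1 (shape only: the mod-24 case gives a character through (ℤ/N)ˣ; this mod-12 even-order statement is NOT asserted in print in this form — cell memo MEMO-an §77)] -/
@[conjecture]
def EtaSquareKummerIsSigmaAtFour : Prop :=
  ∀ (N : ℕ), 4 ∣ N → ∀ r : ℕ → ℤ, NewmanCond N (fun t => 2 * r t) 0 → HasEvenCuspOrders N (fun t => 2 * r t) →
    ∃ χ : DirichletCharacter ℤ N, IsShimuraTwoChar N χ ∧ KummerClassEqShimura N (fun t => 2 * r t) χ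


/-! ## §2 E-an-155 reduced to ONE node (an's checked skeleton EtaSquareSigmaSkeleton-an-g34.lean bb9ba7db8d2011f0) -/

/-- (Ligozat at the cusps `∞` and `0`, PROVED): even orders of `G_{2r}` at `c = N` and `c = 1` are Newman's mod-`24`
congruences for `r` (`cuspOrder24 N (2r) N = 2N·Σ t r_t`, `cuspOrder24 N (2r) 1 = 2·Σ (N/t) r_t`). [folklore] -/
theorem mod24_of_hasEvenCuspOrders (N : ℕ) (r : ℕ → ℤ)
    (hev : HasEvenCuspOrders N (fun t => 2 * r t)) :
    (24 : ℤ) ∣ ∑ t ∈ N.divisors, (t : ℤ) * r t ∧ (24 : ℤ) ∣ ∑ t ∈ N.divisors, ((N / t : ℕ) : ℤ) * r t := by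
  rcases Nat.eq_zero_or_pos N with h0 | hNpos
  · subst h0; simp
  constructor
  · -- the cusp `∞`: `c = N`
    have hmem : N ∈ N.divisors := Nat.mem_divisors_self N hNpos.ne'
    have h := hev N hmem
    rw [Nat.div_self hNpos, Nat.gcd_one_right] at h
    have hco : cuspOrder24 N (fun t => 2 * r t) ((N : ℕ) : ℤ) = 2 * N * ∑ t ∈ N.divisors, (t : ℤ) * r t := by
      unfold cuspOrder24
      rw [Finset.mul_sum]
      refine Finset.sum_congr rfl fun δ hδ => ?_
      have hδN : δ ∣ N := Nat.dvd_of_mem_divisors hδ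
      have hg : Int.gcd (δ : ℤ) (N : ℤ) = δ := by
        rw [Int.gcd_natCast_natCast]; exact Nat.gcd_eq_left hδN
      rw [hg]
      have hdm : ((N / δ : ℕ) : ℤ) * δ = N := by exact_mod_cast Nat.div_mul_cancel hδN
      calc (2 * r δ) * ((δ : ℕ) : ℤ) ^ 2 * ((N / δ : ℕ) : ℤ) = 2 * r δ * δ * (((N / δ : ℕ) : ℤ) * δ) := by ring
        _ = 2 * N * ((δ : ℤ) * r δ) := by rw [hdm]; ring
    rw [hco] at h
    have h' : (2 * (N : ℤ)) * 24 ∣ (2 * (N : ℤ)) * ∑ t ∈ N.divisors, (t : ℤ) * r t := by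
      have e : (48 * (N : ℤ) * ((1 : ℕ) : ℤ)) = 2 * (N : ℤ) * 24 := by push_cast; ring_nf
      rwa [e] at h
    exact (mul_dvd_mul_iff_left (by positivity : (2 * (N : ℤ)) ≠ 0)).mp h'
  · -- the cusp `0`: `c = 1`
    have hmem : 1 ∈ N.divisors := Nat.one_mem_divisors.mpr hNpos.ne'
    have h := hev 1 hmem
    rw [Nat.div_one, Nat.gcd_one_left] at h
    have hco : cuspOrder24 N (fun t => 2 * r t) ((1 : ℕ) : ℤ) = 2 * ∑ t ∈ N.divisors, ((N / t : ℕ) : ℤ) * r t := by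
      unfold cuspOrder24
      rw [Finset.mul_sum]
      refine Finset.sum_congr rfl fun δ _ => ?_
      have hg : Int.gcd (δ : ℤ) ((1 : ℕ) : ℤ) = 1 := by
        rw [Int.gcd_natCast_natCast]; exact Nat.gcd_one_right δ
      rw [hg]; push_cast; ring
    rw [hco] at h
    have h' : (2 : ℤ) * 24 ∣ 2 * ∑ t ∈ N.divisors, ((N / t : ℕ) : ℤ) * r t := by
      have e : (48 * ((1 : ℕ) : ℤ) * ((1 : ℕ) : ℤ)) = 2 * 24 := by norm_num
      rwa [e] at h
    exact (mul_dvd_mul_iff_left (by norm_num : (2 : ℤ) ≠ 0)).mp h'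

/-- **Node S-an-g34-1 `ShimuraTwoCharOfJacobiProductAtFour`** (an's `stub_shimuraTwoChar_of_jacobiProduct`, the number-theoretic heart of
E-an-155; nothing asserted): at `4 ∣ N`, for an η-quotient exponent vector `2r` with Newman's congruences and even cusp orders, the Jacobi part
`∏_t (c/t | |d|)^{r_t}` of Newman's multiplier of `G_r` on `Γ₀(N)` is `χ(d)` for an even quadratic Dirichlet character `χ mod N` killing the cusp
stabilisers (an: by `Σ r_t = 0` it equals `(s₀ | |d|)`, `s₀` the square-free kernel of `∏ t^{r_t}`; reciprocity + the `v₂`-lemma at `4 ∥ N` +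
«stabiliser triviality ⟺ integral orders»; MEMO-an §77.11).  Why it might fail: a `χ₈`-constituent not realised mod `N` at `4 ∥ N` (excluded by
an's `β ≡ 0 (mod 4)` argument, unaudited: R-an-63). [cite: Newman1959, Thm. 1 (shape: the mod-24 multiplier; this mod-12 square statement is the cell's, MEMO-an §77.11)] -/
@[conjecture]
def ShimuraTwoCharOfJacobiProductAtFour : Prop :=
  ∀ (N : ℕ), 4 ∣ N → ∀ r : ℕ → ℤ, NewmanCond N (fun t => 2 * r t) 0 → HasEvenCuspOrders N (fun t => 2 * r t) →
    ∃ χ : DirichletCharacter ℤ N, IsShimuraTwoChar N χ ∧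
      ∀ c d : ℤ, 0 < c → (N : ℤ) ∣ c → IsCoprime c d →
        (∏ t ∈ N.divisors, ((J(c / t | d.natAbs) : ℤ) : ℂ) ^ (r t)) = ((χ (d : ZMod N) : ℤ) : ℂ)

/-- `exp(πi m) = 1` iff `m` is even (the tree's lemma of the same name is private). [folklore] -/
theorem cexp_pi_I_mul_int_eq_one_iff' (m : ℤ) : cexp (π * I * m) = 1 ↔ Even m := by
  constructor
  · intro h
    obtain ⟨n, hn⟩ := Complex.exp_eq_one_iff.mp h
    have hπ : (π : ℂ) * I ≠ 0 := mul_ne_zero (by exact_mod_cast Real.pi_ne_zero) I_ne_zero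
    have : ((m : ℤ) : ℂ) = ((2 * n : ℤ) : ℂ) := by
      have : π * I * (m - 2 * n) = 0 := by linear_combination hn
      have h2 : (m : ℂ) - 2 * n = 0 := by simpa [hπ] using this
      push_cast; linear_combination h2
    exact ⟨n, by have := (Int.cast_injective (α := ℂ)) this; omega⟩
  · rintro ⟨n, rfl⟩
    rw [show (π : ℂ) * I * ((n + n : ℤ) : ℂ) = n * (2 * π * I) by push_cast; ring]
    exact Complex.exp_int_mul_two_pi_mul_I n

/-- A `ℤ`-valued Dirichlet character takes the value `1` or `-1` at a unit. -/
theorem dirichletChar_int_sq_eq_one {N : ℕ} (χ : DirichletCharacter ℤ N) {d : ℤ} (hd : IsCoprime d N) :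
    χ (d : ZMod N) = 1 ∨ χ (d : ZMod N) = -1 := by
  have hu : IsUnit ((d : ZMod N)) := (ZMod.coe_int_isUnit_iff_isCoprime d N).mpr hd.symm
  obtain ⟨u, hu'⟩ := hu
  have hχu : IsUnit (χ (d : ZMod N)) := by
    rw [← hu']
    exact ⟨χ.toUnitHom u, MulChar.coe_toUnitHom χ u⟩
  exact Int.isUnit_eq_one_or hχu

/-- **E-an-155 from the node S-an-g34-1 (an's composition, verbatim with the stub threaded as the hypothesis `hJ`).**  For `γ = (a b; c d) ∈ Γ₀(N)`, `c > 0`, `4 ∣ N`: `d` is odd, the tree theorem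
`sum_rademacherPhi_conj_eq_of_odd` gives `Σ r_t Φ(γ_t) = 24n + 12e` with `e^{πie} = ∏ (c/t | |d|)^{r_t} = χ(d)` (the stub), hence the
log-period of `G_{2r}` is the integer `2n + e`, even iff `χ(d) = 1`. -/
theorem etaSquareKummerIsSigmaAtFour_of_jacobiProduct (hJ : ShimuraTwoCharOfJacobiProductAtFour) :
    EtaSquareKummerIsSigmaAtFour := by
  intro N hN r hnc hev
  obtain ⟨χ, hχ, hprod⟩ := hJ N hN r hnc hev
  refine ⟨χ, hχ, ?_⟩
  intro a b c d hdet hc hNc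
  have hN0 : 0 < N := by
    rcases Nat.eq_zero_or_pos N with h | h
    · exfalso; subst h
      -- `(0:ℤ) ∣ c` contradicts `0 < c`
      simp at hNc; omega
    · exact h
  -- `Σ r_t = 0` from the weight condition of `2r`
  have hsum0 : ∑ t ∈ N.divisors, r t = 0 := by
    have h := hnc.sum_eq
    simp only [mul_zero] at h
    rw [← Finset.mul_sum] at h
    linarith [h]
  obtain ⟨h24a, h24b⟩ := mod24_of_hasEvenCuspOrders N r hev
  -- `d` is odd: `c` is even (`4 ∣ N ∣ c`) and `ad - bc = 1`
  have hceven : Even c := by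
    obtain ⟨k, hk⟩ := hNc
    obtain ⟨m, hm⟩ := hN
    exact ⟨k * 2 * m, by rw [hk, hm]; push_cast; ring⟩
  have hd : Odd d := by
    by_contra h
    rw [Int.not_odd_iff_even] at h
    have : Even (a * d - b * c) := by
      exact Int.even_sub.mpr ⟨fun _ => hceven.mul_left b, fun _ => h.mul_left a⟩
    rw [hdet] at this
    exact Int.not_even_one this
  obtain ⟨n, e, hs, he⟩ := sum_rademacherPhi_conj_eq_of_odd N r hsum0 h24a h24b hdet hc hNc hd
  refine ⟨2 * n + e, ?_, ?_⟩
  · have : ∑ t ∈ N.divisors, (((fun t => 2 * r t) t : ℤ) : ℚ) * rademacherPhi a (t * b) (c / t) d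
        = 2 * ∑ t ∈ N.divisors, (r t : ℚ) * rademacherPhi a (t * b) (c / t) d := by
      rw [Finset.mul_sum]
      refine Finset.sum_congr rfl fun t _ => ?_
      push_cast; ring
    rw [this, hs]; push_cast; ring
  · -- parity of `2n + e` = parity of `e` = `[χ(d) = -1]`
    have hcd : IsCoprime c d := by
      refine ⟨-b, a, ?_⟩; linear_combination hdet
    have hdN : IsCoprime d (N : ℤ) := by
      obtain ⟨k, hk⟩ := hNc
      have : IsCoprime d c := hcd.symm
      rw [hk] at this
      exact this.of_mul_right_left
    have hprod' := hprod c d hc hNc hcd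
    rw [hprod'] at he
    have h2n : Even (2 * n + e) ↔ Even e := by
      constructor
      · intro h; simpa using (Int.even_add.mp h).mp (even_two_mul n)
      · intro h; exact Int.even_add.mpr ⟨fun _ => h, fun _ => even_two_mul n⟩
    rw [h2n, ← cexp_pi_I_mul_int_eq_one_iff' e, he]
    rcases dirichletChar_int_sq_eq_one χ hdN with h1 | h1
    · simp [h1]
    · rw [h1]; norm_num

end Summit.BirchSwinnertonDyer.Rank1Residual.ManinAdditive.SigmaEta
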